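import Summits.QuantumFields.YangMills.Theorems.UnitScaleTiltProp7OneFormGreenSupBound
import Summits.QuantumFields.YangMills.Theorems.UnitScaleTiltProp7SectET3OpsT3HilbertRows
import Summits.QuantumFields.YangMills.Theorems.UnitScaleTiltProp7SectET3WilsonHessianT3RealityRows
import HarnessLib

/-!
# Route `UnitScaleTilt`, crux K1 «MinimiserStabilityRegPr» (stmt-QuantumFields-19200), EX row `norm_G` ∕ (K2)-storey — pen (K2-L1):
# **THE BLOCK-`L¹` COLUMN OF THE GREEN KERNEL `G₀ = Δ_a(U₀)⁻¹` IS `O(1)·e^{−κ₁·blockdist}`, K-FREE** — by duality from the block-supported sup bound (N4 §3)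

Cell `ym3-torus` (HUMAN RULING D-0037; rung R3 = SU(2) YM₃ on T³ — NOT d = 4, NOT infinite volume, NOT a mass gap, NOT Clay).  Width seat `ym3-torus-px16` g13
(`--supports stmt-QuantumFields-19200 --as helper`).  THEOREMS ONLY (0 `def`, 0 `sorry`, default heartbeats); count-neutral.

WHY THIS ROAD.  The (K3)∕(K4) doors (px10 g13 ✓`…KernelCDoorOfKinvEntry` §2) want the `ℓ⁻³` of `C_k(y, y′)` (B. (3.49)); a POINTWISE `ℓ⁻³` row of `G₀` is false near the
diagonal (the true kernel is `~ ℓ⁻²∕dist` inside a block), so the `ℓ⁻³` cannot come from `sup × #bonds`.  It comes from the BLOCK-`L¹` COLUMN: for a source `δ_b ⊗ Z` at one bond,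
`Σ_{bd : B bd₋ = y} |G₀(δ_b ⊗ Z)(bd)| ≤ 2·A₂·e^{−κ₁·tdist(B b₋, y)}·|Z|` with the SAME `O(1)` constant `A₂` as the sup bound — no `ℓ³`.  PROOF = DUALITY: `G₀` is symmetric
(✓`GT_isSymmetric` + ✓`DeltaEta_isSymmetric`), so `c₀·Σ_{bd∈y} ‖G₀δ_bZ(bd)‖_F = ⟪toL2 X, G₀ toL2 δ_bZ⟫ = ⟪G₀ toL2 X, toL2 δ_bZ⟫ = c₀·tr((toL2⁻¹G₀toL2X)(b)ᴴ Z)` for the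
Frobenius-normalised test form `X = 1_y·G₀δ_bZ∕‖G₀δ_bZ‖_F` (`|X| ≤ 1`, supported in the block `y`), and N4 §3 ✓`norm_symm_GT_apply_le_of_blockSupport` bounds
`|(toL2⁻¹G₀toL2X)(b)| ≤ A₂·e^{−κ₁·tdist(B b₋, y)}`; `|tr(AᴴB)| ≤ 2|A||B|` on `M₂(ℂ)` closes.
WHAT IS PROVED (ns `Summit.QuantumFields.YangMills.Theorems.Prop7OneFormGreenBlockColumn`; member `F`, `n ≤ K`).
* §1 fibre algebra on `M₂(ℂ)`: `norm_trace_conjTranspose_mul_le_two_mul_opNorm` (`|tr(AᴴB)| ≤ 2|A||B|`; the Frobenius form is ✓`Prop7DeltaPrimeL2Bound.norm_trace_conjTranspose_mul_le`, not in this import cone), `trace_conjTranspose_frobNormalised_mul` (`tr((M∕‖M‖_F)ᴴ M) = ‖M‖_F`),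
  `norm_frobNormalised_le_one` (`|M∕‖M‖_F| ≤ 1`), `trace_conjTranspose_sum_pi_single` (`Σ_b′ tr(N(b′)ᴴ (δ_b Z)(b′)) = tr(N(b)ᴴ Z)`).
* §2 ★★ `sum_norm_symm_apply_single_le_of_isSymmetric` — THE DUALITY LEMMA for ANY symmetric `T` on the bond space and ANY finite bond set `S`: a sup bound `c` at the bond `b`
  for all test forms supported in `S` with `|X| ≤ 1` gives the `L¹(S)` column bound `Σ_{bd∈S} |toL2⁻¹(T toL2 δ_bZ)(bd)| ≤ 2c|Z|`.
* §3 ★★★ `sum_block_norm_symm_GT_single_le_of_letters` — at the letters of N4 §2∕§3 (= those of ✓`kernelRow_GT_DeltaEtaSlot_rate`):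
  `Σ_{bd : B bd₋ = y} ‖toL2⁻¹(G₀(toL2 δ_bZ)) bd‖ ≤ 2·A₂·e^{−(min r (1∕4)∕2)·tdist(B b₋, y)}·‖Z‖`, `A₂` VERBATIM N4's constant (K-free shape, no `ℓ³`).
HONEST SCOPE.  Duality + N4 §3; CONDITIONAL on every displayed letter (`RegPr`, `PosOnto`, (γ) `hco`, (C_V) `hVlow`, (θ_V-class) `hVconj`, `0 < Θ`, `hkD`, `hkQ`, `hsmall`);
nothing of `norm_G`, the EX rows, EX or the crux is proved; no summit is proved by a helper.

References: T. Bałaban, CMP **99** (1985) 389–434 [Balaban1985BackgroundPropagators] (Thm 3.3 (3.47)–(3.49) pp.398–399, (3.10)–(3.12) p.392, Thm 3.12 p.422);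
T. Bałaban, CMP **98** (1985) 17–51 [Balaban1985Averaging] ((18)–(20) p.21, the fibre norms).
-/

set_option autoImplicit false

noncomputable section

open scoped Matrix.Norms.L2Operator BigOperators InnerProductSpace ComplexConjugate

namespace Summit.QuantumFields.YangMills.Theorems.Prop7OneFormGreenBlockColumn

open Literature.MathematicalPhysics.QuantumFieldTheory.Balaban1983to89
open Literature.MathematicalPhysics.QuantumFieldTheory.Balaban1983to89.T3ContinuumYM3Torus
open Literature.MathematicalPhysics.QuantumFieldTheory.Balaban1983to89.T3PrintedRegularMinimiser (RegPr)
open T3SectALandauChart (formComp bgUnits eta eta_pos)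
open B9SectCLatticeCarrier (Bond)
open B9Eq311L2Pairing (WL2)
open B11Eq103H1Complex (BondL2K)
open B5Eq118OneStroke (iterBlockOf)
open Summit.QuantumFields.YangMills.Theorems.Prop7SectET3Transport (periodsT3 bondEquiv)
open Summit.QuantumFields.YangMills.Theorems.Prop7SectET3HilbertLetters (W₂ frobEquiv toL2 toL2S DL2 DstarL2 inner_toL2 inner_frobEquiv_symm)
open Summit.QuantumFields.YangMills.Theorems.Prop7SectET3WilsonHessian (DeltaEtaSlot DeltaEta_isSymmetric)
open Summit.QuantumFields.YangMills.Theorems.Prop7SectET3GaugeProjector (RS)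
open Summit.QuantumFields.YangMills.Theorems.Prop7SectET3CurvedPropagators (laplaceA Qk GT PosOnto)
open Summit.QuantumFields.YangMills.Theorems.Prop7SectET3OpsT3HilbertRows (GT_isSymmetric)
open Summit.QuantumFields.YangMills.Theorems.Prop7RieszTauFrobNorm (norm_le_norm_frobEquiv_symm norm_frobEquiv_symm_le)
open Summit.QuantumFields.YangMills.Theorems.Prop7OneFormGreenSupBound (norm_symm_GT_apply_le_of_blockSupport)
open Summit.QuantumFields.YangMills.Theorems.Prop7BlockDistanceWeights (tdist_coarse_comm)

variable {F : T3Family} {n K : ℕ} {c₀ : ℝ}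

/-! ## §1 Fibre algebra on `M₂(ℂ)`: trace pairing vs operator norm, the Frobenius-normalised matrix -/

/-- `|tr(Aᴴ B)| ≤ 2·|A|·|B|` on `M₂(ℂ)` (operator norms): Cauchy–Schwarz in `W₂` (✓`inner_frobEquiv_symm`; the Frobenius form is ✓`Prop7DeltaPrimeL2Bound.norm_trace_conjTranspose_mul_le`,
outside this file's import cone) and `‖·‖_F ≤ √2·|·|` (✓`norm_frobEquiv_symm_le`). [cite: Balaban1985Averaging, (18)–(20) p.21] -/
theorem norm_trace_conjTranspose_mul_le_two_mul_opNorm (A B : Matrix (Fin 2) (Fin 2) ℂ) :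
    ‖Matrix.trace (A.conjTranspose * B)‖ ≤ 2 * ‖A‖ * ‖B‖ := by
  rw [← inner_frobEquiv_symm]
  refine (norm_inner_le_norm _ _).trans ?_
  have h2 : Real.sqrt 2 * Real.sqrt 2 = 2 := Real.mul_self_sqrt (by norm_num)
  calc ‖(frobEquiv.symm A : W₂)‖ * ‖(frobEquiv.symm B : W₂)‖ ≤ (Real.sqrt 2 * ‖A‖) * (Real.sqrt 2 * ‖B‖) :=
        mul_le_mul (norm_frobEquiv_symm_le A) (norm_frobEquiv_symm_le B) (norm_nonneg _) (by positivity)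
    _ = 2 * ‖A‖ * ‖B‖ := by rw [mul_mul_mul_comm, h2, mul_assoc]

/-- `tr((M∕‖M‖_F)ᴴ M) = ‖M‖_F` — the Frobenius-normalised matrix pairs with `M` to its Frobenius norm (also when `M = 0`, both sides `0`).
[cite: Balaban1985Averaging, (18) p.21] -/
theorem trace_conjTranspose_frobNormalised_mul (M : Matrix (Fin 2) (Fin 2) ℂ) :
    Matrix.trace (((((‖(frobEquiv.symm M : W₂)‖)⁻¹ : ℝ) : ℂ) • M).conjTranspose * M) = ((‖(frobEquiv.symm M : W₂)‖ : ℝ) : ℂ) := by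
  have h : Matrix.trace (M.conjTranspose * M) = (((‖(frobEquiv.symm M : W₂)‖ ^ 2 : ℝ)) : ℂ) := by
    rw [← inner_frobEquiv_symm, inner_self_eq_norm_sq_to_K]; norm_cast
  rw [Matrix.conjTranspose_smul, RCLike.star_def, Complex.conj_ofReal, Matrix.smul_mul, Matrix.trace_smul, smul_eq_mul, h]
  push_cast
  rw [sq, ← mul_assoc, inv_mul_mul_self]

/-- `|M∕‖M‖_F| ≤ 1` in the operator norm (`|·| ≤ ‖·‖_F`, ✓`norm_le_norm_frobEquiv_symm`). [cite: Balaban1985Averaging, (20) p.21] -/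
theorem norm_frobNormalised_le_one (M : Matrix (Fin 2) (Fin 2) ℂ) :
    ‖(((‖(frobEquiv.symm M : W₂)‖)⁻¹ : ℝ) : ℂ) • M‖ ≤ 1 := by
  rw [norm_smul, Complex.norm_real, Real.norm_of_nonneg (inv_nonneg.mpr (norm_nonneg _))]
  refine (mul_le_mul_of_nonneg_left (norm_le_norm_frobEquiv_symm M) (inv_nonneg.mpr (norm_nonneg _))).trans ?_
  rcases eq_or_ne ‖(frobEquiv.symm M : W₂)‖ 0 with h0 | h0
  · rw [h0]; norm_num
  · rw [inv_mul_cancel₀ h0]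

/-- `Σ_{b′} tr(N(b′)ᴴ · (δ_b ⊗ Z)(b′)) = tr(N(b)ᴴ Z)` — pairing with a one-bond source picks the bond. [cite: Balaban1985BackgroundPropagators, (3.11) p.392] -/
theorem trace_conjTranspose_sum_pi_single (N : PBond (F.P K) 0 → Matrix (Fin 2) (Fin 2) ℂ) (b : PBond (F.P K) 0) (Z : Matrix (Fin 2) (Fin 2) ℂ) :
    ∑ b' : PBond (F.P K) 0, Matrix.trace ((N b').conjTranspose * (Pi.single b Z : PBond (F.P K) 0 → Matrix (Fin 2) (Fin 2) ℂ) b')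
      = Matrix.trace ((N b).conjTranspose * Z) := by
  classical
  rw [Fintype.sum_eq_single b fun b' hb' => by rw [Pi.single_eq_of_ne hb', Matrix.mul_zero, Matrix.trace_zero]]
  rw [Pi.single_eq_same]

/-! ## §2 The duality lemma: a block-supported sup bound for a symmetric `T` is an `L¹`-column bound for `T` -/

/-- ★★ **DUALITY: SUP BOUND ON `S`-SUPPORTED TEST FORMS ⟹ `L¹(S)` COLUMN BOUND**, for ANY symmetric `T` on the fine bond space and ANY finite bond set `S`: if every test
form `X` supported in `S` with `|X(bd)| ≤ 1` has `|toL2⁻¹(T(toL2 X))(b)| ≤ c`, then `Σ_{bd∈S} |toL2⁻¹(T(toL2 (δ_b ⊗ Z)))(bd)| ≤ 2·c·|Z|`.  PROOF: test against the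
Frobenius-normalised `X := 1_S·M∕‖M‖_F`, `M := toL2⁻¹(T toL2 δ_bZ)`: `c₀·Σ_{bd∈S}‖M(bd)‖_F = ⟪toL2 X, T toL2 δ_bZ⟫ = ⟪T toL2 X, toL2 δ_bZ⟫ = c₀·tr((toL2⁻¹T toL2 X)(b)ᴴ Z)`,
then §1. [cite: Balaban1985BackgroundPropagators, (3.10)–(3.12) p.392, (3.47)–(3.49) pp.398–399] -/
theorem sum_norm_symm_apply_single_le_of_isSymmetric [Fact (0 < c₀)]
    (T : BondL2K ℂ 3 (periodsT3 F K) c₀ W₂ →ₗ[ℂ] BondL2K ℂ 3 (periodsT3 F K) c₀ W₂) (hT : T.IsSymmetric)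
    (S : Finset (PBond (F.P K) 0)) (b : PBond (F.P K) 0) {c : ℝ}
    (hrow : ∀ X : PBond (F.P K) 0 → Matrix (Fin 2) (Fin 2) ℂ, (∀ bd, X bd ≠ 0 → bd ∈ S) → (∀ bd, ‖X bd‖ ≤ 1) →
      ‖(toL2 F K c₀).symm (T (toL2 F K c₀ X)) b‖ ≤ c)
    (Z : Matrix (Fin 2) (Fin 2) ℂ) :
    ∑ bd ∈ S, ‖(toL2 F K c₀).symm (T (toL2 F K c₀ (Pi.single b Z))) bd‖ ≤ 2 * c * ‖Z‖ := by
  classical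
  have hc₀ : 0 < c₀ := Fact.out
  set M : PBond (F.P K) 0 → Matrix (Fin 2) (Fin 2) ℂ := (toL2 F K c₀).symm (T (toL2 F K c₀ (Pi.single b Z))) with hM
  -- the Frobenius-normalised test form supported in `S`
  set X : PBond (F.P K) 0 → Matrix (Fin 2) (Fin 2) ℂ :=
    fun bd => if bd ∈ S then (((‖(frobEquiv.symm (M bd) : W₂)‖)⁻¹ : ℝ) : ℂ) • M bd else 0 with hX
  have hXS : ∀ bd, X bd ≠ 0 → bd ∈ S := fun bd hbd => by
    by_contra hS
    exact hbd (by rw [hX]; exact if_neg hS)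
  have hX1 : ∀ bd, ‖X bd‖ ≤ 1 := fun bd => by
    by_cases hS : bd ∈ S
    · rw [hX]; dsimp only; rw [if_pos hS]; exact norm_frobNormalised_le_one (M bd)
    · rw [hX]; dsimp only; rw [if_neg hS, norm_zero]; exact zero_le_one
  set N : PBond (F.P K) 0 → Matrix (Fin 2) (Fin 2) ℂ := (toL2 F K c₀).symm (T (toL2 F K c₀ X)) with hN
  have hNb : ‖N b‖ ≤ c := hrow X hXS hX1
  set σ : ℝ := ∑ bd ∈ S, ‖(frobEquiv.symm (M bd) : W₂)‖ with hσ
  -- the trace pairing of the test form with `M`, bond by bond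
  have htr : ∀ bd, Matrix.trace ((X bd).conjTranspose * M bd) = if bd ∈ S then (((‖(frobEquiv.symm (M bd) : W₂)‖ : ℝ) : ℂ)) else 0 := fun bd => by
    by_cases hS : bd ∈ S
    · rw [if_pos hS, hX]; dsimp only; rw [if_pos hS]; exact trace_conjTranspose_frobNormalised_mul (M bd)
    · rw [if_neg hS, hX]; dsimp only; rw [if_neg hS, Matrix.conjTranspose_zero, Matrix.zero_mul, Matrix.trace_zero]
  have hpair : ⟪toL2 F K c₀ X, toL2 F K c₀ M⟫_ℂ = (c₀ : ℂ) * ((σ : ℝ) : ℂ) := by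
    rw [inner_toL2, hσ]
    congr 1
    push_cast
    rw [Finset.sum_congr rfl fun bd _ => htr bd, Finset.sum_ite_mem, Finset.univ_inter]
  -- duality: `⟪toL2 X, T toL2 δ⟫ = ⟪T toL2 X, toL2 δ⟫ = c₀ tr(N(b)ᴴ Z)`
  have hdual : (c₀ : ℂ) * ((σ : ℝ) : ℂ) = (c₀ : ℂ) * Matrix.trace ((N b).conjTranspose * Z) := by
    rw [← hpair, hM, LinearEquiv.apply_symm_apply, ← hT, ← trace_conjTranspose_sum_pi_single N b Z, ← inner_toL2, hN,
      LinearEquiv.apply_symm_apply]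
  have hσle : σ ≤ 2 * c * ‖Z‖ := by
    have h1 : ‖(c₀ : ℂ) * ((σ : ℝ) : ℂ)‖ ≤ c₀ * (2 * ‖N b‖ * ‖Z‖) := by
      rw [hdual, norm_mul, Complex.norm_real, Real.norm_of_nonneg hc₀.le]
      exact mul_le_mul_of_nonneg_left (norm_trace_conjTranspose_mul_le_two_mul_opNorm _ _) hc₀.le
    have hσ0 : 0 ≤ σ := by rw [hσ]; exact Finset.sum_nonneg fun _ _ => norm_nonneg _
    rw [norm_mul, Complex.norm_real, Complex.norm_real, Real.norm_of_nonneg hc₀.le, Real.norm_of_nonneg hσ0] at h1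
    have h2 : σ ≤ 2 * ‖N b‖ * ‖Z‖ := le_of_mul_le_mul_left h1 hc₀
    exact h2.trans (mul_le_mul_of_nonneg_right (mul_le_mul_of_nonneg_left hNb zero_le_two) (norm_nonneg _))
  calc ∑ bd ∈ S, ‖M bd‖ ≤ σ := Finset.sum_le_sum fun bd _ => norm_le_norm_frobEquiv_symm (M bd)
    _ ≤ 2 * c * ‖Z‖ := hσle

/-! ## §3 The block-`L¹` column of `G₀ = Δ_a(U₀)⁻¹` at the slot of record, K-free -/

variable [Fact (0 < c₀)] {h : n ≤ K} {cB a : ℝ} [Fact (0 < cB)]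

/-- ★★★ **THE BLOCK-`L¹` COLUMN BOUND FOR THE GREEN KERNEL, K-FREE**: at the letters of N4 ✓`norm_symm_GT_apply_le_of_blockSupport` (= those of
✓`kernelRow_GT_DeltaEtaSlot_rate`: `RegPr`, `PosOnto`, (γ) `hco`, (C_V) `hVlow`, (θ_V-class) `hVconj`, `0 < Θ`, `hkD`, `hkQ` at rate `μ′ > r`, `hsmall`), for every bond `b`,
matrix `Z` and block `y`: `Σ_{bd : B bd₋ = y} ‖toL2⁻¹(G₀(toL2 (δ_b ⊗ Z))) bd‖ ≤ 2·A₂·e^{−(min r (1∕4)∕2)·tdist(B b₋, y)}·‖Z‖`, `A₂` VERBATIM N4's constant — the `O(1)`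
block-`L¹` column (B. (3.47)–(3.49): the `ℓ⁻³` of `C_k` is THIS bound composed with `Q_k`'s `ℓ⁻³`-average, not a pointwise `ℓ⁻³` row of `G`).  PROOF: §2 for `T := G₀`
(symmetric: ✓`GT_isSymmetric`, ✓`DeltaEta_isSymmetric`), `S :=` the bonds of block `y`, `c :=` N4 §3 at `s := 1`.  CONDITIONAL on every displayed letter.
[cite: Balaban1985BackgroundPropagators, Thm 3.3 (3.47)–(3.49) pp.398–399, (3.10) p.392, Thm 3.12 p.422] -/
theorem sum_block_norm_symm_GT_single_le_of_letters (hnK : n ≤ K) {ε₀ : ℝ} (hε₀ : 0 ≤ ε₀) (U₀ : GaugeField (F.P K) 0 (Matrix.specialUnitaryGroup (Fin 2) ℂ))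
    (hreg : RegPr F n K ε₀ U₀) (hp : PosOnto F n K h c₀ cB a (DeltaEtaSlot F n K c₀) U₀)
    {r : ℝ} (hr : 0 < r) {γ CV θV ε : ℝ} (hε : 0 < ε) (hε1 : ε ≤ 1)
    (hco : ∀ v : BondL2K ℂ 3 (periodsT3 F K) c₀ W₂, γ * ‖v‖ ^ 2 ≤ RCLike.re ⟪v, laplaceA F n K h c₀ cB a (DeltaEtaSlot F n K c₀) U₀ v⟫_ℂ)
    (hVlow : ∀ X : PBond (F.P K) 0 → Matrix (Fin 2) (Fin 2) ℂ,
      -(CV * ‖toL2 F K c₀ X‖ ^ 2) ≤ RCLike.re ⟪toL2 F K c₀ X, laplaceA F n K h c₀ cB a (DeltaEtaSlot F n K c₀) U₀ (toL2 F K c₀ X)⟫_ℂ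
        - ∑ μ : Fin (F.P K).d, ‖DL2 F n K c₀ U₀ (toL2S F K c₀ (formComp X μ))‖ ^ 2)
    (hVconj : ∀ φ : Site (F.P K) 0 → ℝ, (∀ x x' : Site (F.P K) 0, |φ x - φ x'| ≤ r * eta F n K * (Site.tdist x x' : ℝ)) →
      ∀ X : PBond (F.P K) 0 → Matrix (Fin 2) (Fin 2) ℂ,
      RCLike.re ⟪toL2 F K c₀ X, laplaceA F n K h c₀ cB a (DeltaEtaSlot F n K c₀) U₀ (toL2 F K c₀ X)⟫_ℂ
          - (∑ μ : Fin (F.P K).d, ‖DL2 F n K c₀ U₀ (toL2S F K c₀ (formComp X μ))‖ ^ 2) - θV * ‖toL2 F K c₀ X‖ ^ 2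
        ≤ RCLike.re ⟪toL2 F K c₀ (fun b => Real.exp (φ b.src) • X b), laplaceA F n K h c₀ cB a (DeltaEtaSlot F n K c₀) U₀ (toL2 F K c₀ (fun b => (Real.exp (φ b.src))⁻¹ • X b))⟫_ℂ
          - RCLike.re (∑ μ : Fin (F.P K).d, ⟪DL2 F n K c₀ U₀ (toL2S F K c₀ (formComp (fun b => Real.exp (φ b.src) • X b) μ)),
              DL2 F n K c₀ U₀ (toL2S F K c₀ (formComp (fun b => (Real.exp (φ b.src))⁻¹ • X b) μ))⟫_ℂ))
    (hΘ : 0 < ((1 - ε) * γ - ε * CV - 3 * (r ^ 2 * Real.exp (2 * r)) * (1 + 1 / ε) - θV))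
    {CkD CkQ μ' : ℝ} (hCkD : 0 ≤ CkD) (hCkQ : 0 ≤ CkQ) (hrμ : r < μ')
    (hkD : ∀ (b : PBond (F.P K) 0) (Z : Matrix (Fin 2) (Fin 2) ℂ) (bd : PBond (F.P K) 0),
      ‖(toL2 F K c₀).symm (DL2 F n K c₀ U₀ (DstarL2 F n K c₀ U₀ (toL2 F K c₀ (Pi.single b Z))
          - RS F n K h c₀ cB U₀ (DstarL2 F n K c₀ U₀ (toL2 F K c₀ (Pi.single b Z))))) bd‖
        ≤ CkD * Real.exp (-(μ' * (Site.tdist (P := F.P K) (iterBlockOf (K - n) b.src) (iterBlockOf (K - n) bd.src) : ℝ))) * ‖Z‖)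
    (hkQ : ∀ (b : PBond (F.P K) 0) (Z : Matrix (Fin 2) (Fin 2) ℂ) (bd : PBond (F.P K) 0),
      ‖(toL2 F K c₀).symm (LinearMap.adjoint (Qk F n K h c₀ cB U₀) (((a : ℝ) : ℂ) • Qk F n K h c₀ cB U₀ (toL2 F K c₀ (Pi.single b Z)))) bd‖
        ≤ CkQ * Real.exp (-(μ' * (Site.tdist (P := F.P K) (iterBlockOf (K - n) b.src) (iterBlockOf (K - n) bd.src) : ℝ))) * ‖Z‖)
    (hsmall : (32 * Real.sqrt 2 * ε₀ * Real.exp (5 * r)) * (8 * Real.exp (3 * r)) * 14 < 1)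
    (b : PBond (F.P K) 0) (Z : Matrix (Fin 2) (Fin 2) ℂ) (y : Site (F.P K) (K - n)) :
    ∑ bd ∈ Finset.univ.filter (fun bd : PBond (F.P K) 0 => iterBlockOf (K - n) bd.src = y),
        ‖(toL2 F K c₀).symm (GT F n K h c₀ cB a (DeltaEtaSlot F n K c₀) U₀ (toL2 F K c₀ (Pi.single b Z))) bd‖
      ≤ 2 * ((((Real.sqrt 2 + Real.sqrt 2 * ((CkQ + CkD) * Real.sqrt (((F.P K).d : ℝ) * ((((F.P K).L : ℝ) ^ (F.P K).d) ^ (K - n)) / c₀) * (Real.exp (6 * r) * Real.sqrt (2 * c₀ * (((F.P K).d : ℝ) * ((((F.P K).L : ℝ) ^ (F.P K).d) ^ (K - n)))) / ((1 - ε) * γ - ε * CV - 3 * (r ^ 2 * Real.exp (2 * r)) * (1 + 1 / ε) - θV)) * (2 * (1 + 1 / (μ' - r))) ^ 3)) * (8 * Real.exp (3 * r)) * 14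
              + Real.sqrt (3 ^ 3 * 8 / (c₀ * ((F.L : ℝ) ^ (K - n)) ^ 3)) * (Real.sqrt (8 * Real.exp (3 * r) * (2 * (1 + 1 / r)) ^ 3) * (Real.exp (6 * r) * Real.sqrt (2 * c₀ * (((F.P K).d : ℝ) * ((((F.P K).L : ℝ) ^ (F.P K).d) ^ (K - n)))) / ((1 - ε) * γ - ε * CV - 3 * (r ^ 2 * Real.exp (2 * r)) * (1 + 1 / ε) - θV))))
            / (1 - (32 * Real.sqrt 2 * ε₀ * Real.exp (5 * r)) * (8 * Real.exp (3 * r)) * 14))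
          * Real.exp (-((min r (1 / 4) / 2) * (Site.tdist (iterBlockOf (K - n) b.src) y : ℝ)))) * ‖Z‖ := by
  classical
  refine sum_norm_symm_apply_single_le_of_isSymmetric (GT F n K h c₀ cB a (DeltaEtaSlot F n K c₀) U₀)
    (GT_isSymmetric (h := h) (cB := cB) (a := a) hp (DeltaEta_isSymmetric (F := F) (n := n) (K := K) (c₀ := c₀) U₀)) _ b
    (fun X hXS hX1 => ?_) Z
  have hXy : ∀ bd, X bd ≠ 0 → iterBlockOf (K - n) bd.src = y := fun bd hbd => (Finset.mem_filter.mp (hXS bd hbd)).2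
  have h1 := norm_symm_GT_apply_le_of_blockSupport (h := h) (cB := cB) (a := a) hnK hε₀ U₀ hreg hp hr hε hε1 hco hVlow hVconj hΘ hCkD hCkQ hrμ hkD hkQ
    hsmall X y hXy zero_le_one hX1 b
  rw [one_mul] at h1
  exact h1

/-- ★★★ **THE SAME, IN THE LETTER SHAPE OF THE (K3)∕(K4) DOORS** (px10 g13 ⧗`kernelC_of_kinvRow_of_greenColumn`'s `hGcol` at `Δx := DeltaEtaSlot`, VERBATIM: `∀ b Z y, Σ_{bd : B bd₋ = y} … ≤
C_G·e^{−δ·tdist(y, B b₋)}·‖Z‖`) with `C_G := 2·A₂` (K-free shape, `O(1)`: no `ℓ³`) and `δ := min r (1∕4)∕2`.  CONDITIONAL on every displayed letter.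
[cite: Balaban1985BackgroundPropagators, Thm 3.3 (3.46)–(3.49) pp.398–399, Thm 3.12 p.422] -/
theorem blockColumn_GT_DeltaEtaSlot_of_letters (hnK : n ≤ K) {ε₀ : ℝ} (hε₀ : 0 ≤ ε₀) (U₀ : GaugeField (F.P K) 0 (Matrix.specialUnitaryGroup (Fin 2) ℂ))
    (hreg : RegPr F n K ε₀ U₀) (hp : PosOnto F n K h c₀ cB a (DeltaEtaSlot F n K c₀) U₀)
    {r : ℝ} (hr : 0 < r) {γ CV θV ε : ℝ} (hε : 0 < ε) (hε1 : ε ≤ 1)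
    (hco : ∀ v : BondL2K ℂ 3 (periodsT3 F K) c₀ W₂, γ * ‖v‖ ^ 2 ≤ RCLike.re ⟪v, laplaceA F n K h c₀ cB a (DeltaEtaSlot F n K c₀) U₀ v⟫_ℂ)
    (hVlow : ∀ X : PBond (F.P K) 0 → Matrix (Fin 2) (Fin 2) ℂ,
      -(CV * ‖toL2 F K c₀ X‖ ^ 2) ≤ RCLike.re ⟪toL2 F K c₀ X, laplaceA F n K h c₀ cB a (DeltaEtaSlot F n K c₀) U₀ (toL2 F K c₀ X)⟫_ℂ
        - ∑ μ : Fin (F.P K).d, ‖DL2 F n K c₀ U₀ (toL2S F K c₀ (formComp X μ))‖ ^ 2)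
    (hVconj : ∀ φ : Site (F.P K) 0 → ℝ, (∀ x x' : Site (F.P K) 0, |φ x - φ x'| ≤ r * eta F n K * (Site.tdist x x' : ℝ)) →
      ∀ X : PBond (F.P K) 0 → Matrix (Fin 2) (Fin 2) ℂ,
      RCLike.re ⟪toL2 F K c₀ X, laplaceA F n K h c₀ cB a (DeltaEtaSlot F n K c₀) U₀ (toL2 F K c₀ X)⟫_ℂ
          - (∑ μ : Fin (F.P K).d, ‖DL2 F n K c₀ U₀ (toL2S F K c₀ (formComp X μ))‖ ^ 2) - θV * ‖toL2 F K c₀ X‖ ^ 2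
        ≤ RCLike.re ⟪toL2 F K c₀ (fun b => Real.exp (φ b.src) • X b), laplaceA F n K h c₀ cB a (DeltaEtaSlot F n K c₀) U₀ (toL2 F K c₀ (fun b => (Real.exp (φ b.src))⁻¹ • X b))⟫_ℂ
          - RCLike.re (∑ μ : Fin (F.P K).d, ⟪DL2 F n K c₀ U₀ (toL2S F K c₀ (formComp (fun b => Real.exp (φ b.src) • X b) μ)),
              DL2 F n K c₀ U₀ (toL2S F K c₀ (formComp (fun b => (Real.exp (φ b.src))⁻¹ • X b) μ))⟫_ℂ))
    (hΘ : 0 < ((1 - ε) * γ - ε * CV - 3 * (r ^ 2 * Real.exp (2 * r)) * (1 + 1 / ε) - θV))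
    {CkD CkQ μ' : ℝ} (hCkD : 0 ≤ CkD) (hCkQ : 0 ≤ CkQ) (hrμ : r < μ')
    (hkD : ∀ (b : PBond (F.P K) 0) (Z : Matrix (Fin 2) (Fin 2) ℂ) (bd : PBond (F.P K) 0),
      ‖(toL2 F K c₀).symm (DL2 F n K c₀ U₀ (DstarL2 F n K c₀ U₀ (toL2 F K c₀ (Pi.single b Z))
          - RS F n K h c₀ cB U₀ (DstarL2 F n K c₀ U₀ (toL2 F K c₀ (Pi.single b Z))))) bd‖
        ≤ CkD * Real.exp (-(μ' * (Site.tdist (P := F.P K) (iterBlockOf (K - n) b.src) (iterBlockOf (K - n) bd.src) : ℝ))) * ‖Z‖)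
    (hkQ : ∀ (b : PBond (F.P K) 0) (Z : Matrix (Fin 2) (Fin 2) ℂ) (bd : PBond (F.P K) 0),
      ‖(toL2 F K c₀).symm (LinearMap.adjoint (Qk F n K h c₀ cB U₀) (((a : ℝ) : ℂ) • Qk F n K h c₀ cB U₀ (toL2 F K c₀ (Pi.single b Z)))) bd‖
        ≤ CkQ * Real.exp (-(μ' * (Site.tdist (P := F.P K) (iterBlockOf (K - n) b.src) (iterBlockOf (K - n) bd.src) : ℝ))) * ‖Z‖)
    (hsmall : (32 * Real.sqrt 2 * ε₀ * Real.exp (5 * r)) * (8 * Real.exp (3 * r)) * 14 < 1) :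
    ∀ (b : PBond (F.P K) 0) (Z : Matrix (Fin 2) (Fin 2) ℂ) (y : Site (F.P K) (K - n)),
      ∑ bd ∈ Finset.univ.filter (fun bd : PBond (F.P K) 0 => iterBlockOf (K - n) bd.src = y),
          ‖(toL2 F K c₀).symm (GT F n K h c₀ cB a (DeltaEtaSlot F n K c₀) U₀ (toL2 F K c₀ (Pi.single b Z))) bd‖
        ≤ 2 * (((Real.sqrt 2 + Real.sqrt 2 * ((CkQ + CkD) * Real.sqrt (((F.P K).d : ℝ) * ((((F.P K).L : ℝ) ^ (F.P K).d) ^ (K - n)) / c₀) * (Real.exp (6 * r) * Real.sqrt (2 * c₀ * (((F.P K).d : ℝ) * ((((F.P K).L : ℝ) ^ (F.P K).d) ^ (K - n)))) / ((1 - ε) * γ - ε * CV - 3 * (r ^ 2 * Real.exp (2 * r)) * (1 + 1 / ε) - θV)) * (2 * (1 + 1 / (μ' - r))) ^ 3)) * (8 * Real.exp (3 * r)) * 14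
              + Real.sqrt (3 ^ 3 * 8 / (c₀ * ((F.L : ℝ) ^ (K - n)) ^ 3)) * (Real.sqrt (8 * Real.exp (3 * r) * (2 * (1 + 1 / r)) ^ 3) * (Real.exp (6 * r) * Real.sqrt (2 * c₀ * (((F.P K).d : ℝ) * ((((F.P K).L : ℝ) ^ (F.P K).d) ^ (K - n)))) / ((1 - ε) * γ - ε * CV - 3 * (r ^ 2 * Real.exp (2 * r)) * (1 + 1 / ε) - θV))))
            / (1 - (32 * Real.sqrt 2 * ε₀ * Real.exp (5 * r)) * (8 * Real.exp (3 * r)) * 14))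
          * Real.exp (-((min r (1 / 4) / 2) * (Site.tdist (P := F.P K) y (iterBlockOf (K - n) b.src) : ℝ))) * ‖Z‖ := by
  intro b Z y
  have h3 := sum_block_norm_symm_GT_single_le_of_letters (h := h) (cB := cB) (a := a) hnK hε₀ U₀ hreg hp hr hε hε1 hco hVlow hVconj hΘ hCkD hCkQ hrμ hkD hkQ
    hsmall b Z y
  rw [tdist_coarse_comm F y (iterBlockOf (K - n) b.src)]
  simpa only [mul_assoc] using h3

end Summit.QuantumFields.YangMills.Theorems.Prop7OneFormGreenBlockColumn

end
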